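import Literature.NumberTheory.IwasawaTheory.Greenberg2006.WeakLeopoldtAboveCyclotomicProof
import HarnessLib

/-!
# Greenberg 2006, the LEO road for twist deformations — UNCONDITIONAL (the (T4) binder discharged)

Topic `NumberTheory/IwasawaTheory/Greenberg2006`; namespace `Literature.NumberTheory.IwasawaTheory.Greenberg2006`.
Theorems only (no definition, no named fact, no instance; D-0026).  Width seat `bsd-line-x1-p1-w2`
gen 8 of cell `bsd-eis`, D-0154 (2) INPUTS lane.

`TwistDeformationLEO.lean` §6 proves, MODULO the single named fact (T4)
`weakLeopoldt_H2_subsingleton_above_cyclotomic_of_isOpen` (binder `hT4`), Greenberg's hypotheses for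
the two-variable twist deformation `𝐃 = Ind_{K̃_∞/K} A` of a corank-one `ℤ_p`-module `A ≃ ℚ_p/ℤ_p`
twisted by a continuous character `θ` of `G_{K,S}` of order prime to `p`, over a number field `K` with
`(κ₁, κ₂)` jointly onto `ℤ_p²` and `K̃_∞ ⊇ K^{cyc}`, `p` odd: `H²(K_Σ/K̃_∞, A) = 0`, `H²(K_Σ/K, 𝐃) = 0`,
LEO(`𝐃`), `corank_{Λ₂} H²(K_Σ/K, 𝐃) = 0`, and the same for Keller–Yin's character.  (T4) is now a
THEOREM of the Literature tree (`WeakLeopoldtAboveCyclotomicProof.weakLeopoldt_H2_subsingleton_above_cyclotomic_of_isOpen_holds`,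
from Iwasawa's cyclotomic weak Leopoldt `WeakLeopoldtCyclotomicProof.…_holds`), so each §6 theorem
holds UNCONDITIONALLY; this file records the seven discharged statements, binder for binder:

* `restrict_galoisGroupAbove_H2_subsingleton` — `H²(K_Σ/K̃_∞, A) = 0` (general scalar model);
* `twistDeformation_H2_subsingleton`, **`twistDeformation_LEO`** (`LEO S (twistDeformation S hS κ₁ κ₂ ρ₀)`,
  Greenberg 2016 §2.2's hypothesis LEO(𝐃) — the binder `hLEO` of the cell's instance theorems),
  `twistDeformation_hasCorank_H2_zero`;
* `twistDeformation_LEO_of_unitChar'`, `twistDeformation_hasCorank_H2_zero_of_unitChar'` — the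
  Keller–Yin character instances;
* **`weakLeopoldtAbove`** — the statement of the former stub `stub_weakLeopoldtAbove` of the crux line
  `halves` (v6) of `Summits/BirchSwinnertonDyer/…/GoodLatticeBDPValue`, now a hypothesis-free theorem.

HONEST FRAMING: Galois-cohomological structure theorems (Greenberg 2006 Thm. 3 / pp. 343–344,
Serre I §2.4 Prop. 9) made unconditional by Iwasawa's theorem; no main conjecture, no case of BSD and
no statement about `p`-adic `L`-functions is proved here.

References: [Greenberg2006] Thm. 3 (p. 342), pp. 343–344; [Greenberg2016Selmer] §2.2–§2.3;
[NguyenQuangDo1984] Thm. 2.2; [SerreGaloisCohomology1997] I §2.4 Prop. 9; [KellerYin2024] §1.1.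
-/

noncomputable section

open scoped Classical
open NumberField IsDedekindDomain Field
open Literature.NumberTheory.GaloisRepresentations
open Literature.NumberTheory.EllipticCurves (ZpExtension)
open Literature.NumberTheory.IwasawaTheory
open Literature.NumberTheory.IwasawaTheory.Greenberg2016

namespace Literature.NumberTheory.IwasawaTheory.Greenberg2006

section KernelDescent

variable {K : Type} [Field K] [NumberField K] {p : ℕ} [Fact p.Prime]
  {S : Set (HeightOneSpectrum (𝓞 K))}

/-- **`H²(K_Σ/K̃_∞, A) = 0` for a corank-one coefficient twisted by a character of order prime to
`p` — UNCONDITIONAL** (`restrict_galoisGroupAbove_H2_subsingleton_of_T4` with (T4) discharged).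
[cite: Greenberg2006, pp. 343–344, Thm. 3 p. 342] [cite: SerreGaloisCohomology1997, Ch. I §2.4, Proposition 9] -/
theorem restrict_galoisGroupAbove_H2_subsingleton
    (hp : p ≠ 2) (hSf : S.Finite)
    (hS : ∀ v : HeightOneSpectrum (𝓞 K), ((p : ℕ) : 𝓞 K) ∈ v.asIdeal → v ∈ S)
    (κ₁ κ₂ : ZpExtension K p)
    (hcyc : ∀ σ : absoluteGaloisGroup K, σ ∈ multiZpKer p ![κ₁, κ₂] →
      GaloisRep.cyclotomicCharacter K p σ ∈ CommGroup.torsion ℤ_[p]ˣ)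
    {A : Type} [AddCommGroup A] [Module ℤ_[p] A] [TopologicalSpace A] [DiscreteTopology A]
    [ContinuousSMul ℤ_[p] A] (hA : Nonempty (A ≃+ ℚ_[p] ⧸ (PadicInt.subring p).toAddSubgroup))
    (ρ₀ : ContinuousRep (GaloisGroupUnramifiedOutside K S) ℤ_[p] A)
    (θ : GaloisGroupUnramifiedOutside K S →ₜ* ℤ_[p]ˣ)
    (hρ₀ : ∀ (g : GaloisGroupUnramifiedOutside K S) (a : A), ρ₀ g a = ((θ g : ℤ_[p]ˣ) : ℤ_[p]) • a)
    (hθ : Nat.Coprime (Nat.card θ.toMonoidHom.range) p) :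
    Subsingleton ((ρ₀.restrict (galoisGroupAboveSubtype S (multiZpKer p ![κ₁, κ₂]))).H 2) :=
  restrict_galoisGroupAbove_H2_subsingleton_of_T4
    weakLeopoldt_H2_subsingleton_above_cyclotomic_of_isOpen_holds hp hSf hS κ₁ κ₂ hcyc hA ρ₀ θ hρ₀ hθ

variable [TopologicalSpace (PowerSeries ℤ_[p])] [TopologicalSpace (PowerSeries (PowerSeries ℤ_[p]))]

/-- **`H²(K_Σ/K, Ind_{K̃_∞/K} A) = 0`, general scalar model — UNCONDITIONAL**
(`twistDeformation_H2_subsingleton_of_T4` with (T4) discharged).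
[cite: Greenberg2006, Thm. 3 p. 342, pp. 343–344] [cite: SerreGaloisCohomology1997, Ch. I §2.4, Proposition 9] -/
theorem twistDeformation_H2_subsingleton
    (hp : p ≠ 2) (hSf : S.Finite)
    (hS : ∀ v : HeightOneSpectrum (𝓞 K), ((p : ℕ) : 𝓞 K) ∈ v.asIdeal → v ∈ S)
    {κ₁ κ₂ : ZpExtension K p}
    (hκ : Function.Surjective (fun σ : absoluteGaloisGroup K ↦ (κ₁ σ, κ₂ σ)))
    (hcyc : ∀ σ : absoluteGaloisGroup K, σ ∈ multiZpKer p ![κ₁, κ₂] →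
      GaloisRep.cyclotomicCharacter K p σ ∈ CommGroup.torsion ℤ_[p]ˣ)
    {A : Type} [AddCommGroup A] [Module ℤ_[p] A] [TopologicalSpace A] [DiscreteTopology A]
    [ContinuousSMul ℤ_[p] A] (hA : Nonempty (A ≃+ ℚ_[p] ⧸ (PadicInt.subring p).toAddSubgroup))
    (ρ₀ : ContinuousRep (GaloisGroupUnramifiedOutside K S) ℤ_[p] A)
    (θ : GaloisGroupUnramifiedOutside K S →ₜ* ℤ_[p]ˣ)
    (hρ₀ : ∀ (g : GaloisGroupUnramifiedOutside K S) (a : A), ρ₀ g a = ((θ g : ℤ_[p]ˣ) : ℤ_[p]) • a)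
    (hθ : Nat.Coprime (Nat.card θ.toMonoidHom.range) p)
    [ContinuousSMul (PowerSeries (PowerSeries ℤ_[p])) (IndModule₂ ℤ_[p] p A)] :
    Subsingleton ((twistDeformation S hS κ₁ κ₂ ρ₀).H 2) :=
  twistDeformation_H2_subsingleton_of_T4
    weakLeopoldt_H2_subsingleton_above_cyclotomic_of_isOpen_holds hp hSf hS hκ hcyc hA ρ₀ θ hρ₀ hθ

/-- **LEO(`𝐃`) for the general scalar model — UNCONDITIONAL** (Greenberg 2016 §2.2's hypothesis
LEO(𝐃) for the two-variable twist deformation; `twistDeformation_LEO_of_T4` with (T4) discharged).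
[cite: Greenberg2016Selmer, §2.2 p. 6 L22–30 (LEO(𝐃))] [cite: Greenberg2006, pp. 343–344, Thm. 3 p. 342] -/
theorem twistDeformation_LEO
    (hp : p ≠ 2) (hSf : S.Finite)
    (hS : ∀ v : HeightOneSpectrum (𝓞 K), ((p : ℕ) : 𝓞 K) ∈ v.asIdeal → v ∈ S)
    {κ₁ κ₂ : ZpExtension K p}
    (hκ : Function.Surjective (fun σ : absoluteGaloisGroup K ↦ (κ₁ σ, κ₂ σ)))
    (hcyc : ∀ σ : absoluteGaloisGroup K, σ ∈ multiZpKer p ![κ₁, κ₂] →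
      GaloisRep.cyclotomicCharacter K p σ ∈ CommGroup.torsion ℤ_[p]ˣ)
    {A : Type} [AddCommGroup A] [Module ℤ_[p] A] [TopologicalSpace A] [DiscreteTopology A]
    [ContinuousSMul ℤ_[p] A] (hA : Nonempty (A ≃+ ℚ_[p] ⧸ (PadicInt.subring p).toAddSubgroup))
    (ρ₀ : ContinuousRep (GaloisGroupUnramifiedOutside K S) ℤ_[p] A)
    (θ : GaloisGroupUnramifiedOutside K S →ₜ* ℤ_[p]ˣ)
    (hρ₀ : ∀ (g : GaloisGroupUnramifiedOutside K S) (a : A), ρ₀ g a = ((θ g : ℤ_[p]ˣ) : ℤ_[p]) • a)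
    (hθ : Nat.Coprime (Nat.card θ.toMonoidHom.range) p)
    [IsTopologicalAddGroup (IndModule₂ ℤ_[p] p A)]
    [ContinuousSMul (PowerSeries (PowerSeries ℤ_[p])) (IndModule₂ ℤ_[p] p A)] :
    LEO S (twistDeformation S hS κ₁ κ₂ ρ₀) :=
  twistDeformation_LEO_of_T4
    weakLeopoldt_H2_subsingleton_above_cyclotomic_of_isOpen_holds hp hSf hS hκ hcyc hA ρ₀ θ hρ₀ hθ

/-- **`corank_{Λ₂} H²(K_Σ/K, 𝐃) = 0` for the general scalar model — UNCONDITIONAL**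
(`twistDeformation_hasCorank_H2_zero_of_T4` with (T4) discharged).
[cite: Greenberg2016Selmer, §2.3 p. 7 L1–17 (coranks)] [cite: Greenberg2006, pp. 343–344, Thm. 3 p. 342] -/
theorem twistDeformation_hasCorank_H2_zero
    (hp : p ≠ 2) (hSf : S.Finite)
    (hS : ∀ v : HeightOneSpectrum (𝓞 K), ((p : ℕ) : 𝓞 K) ∈ v.asIdeal → v ∈ S)
    {κ₁ κ₂ : ZpExtension K p}
    (hκ : Function.Surjective (fun σ : absoluteGaloisGroup K ↦ (κ₁ σ, κ₂ σ)))
    (hcyc : ∀ σ : absoluteGaloisGroup K, σ ∈ multiZpKer p ![κ₁, κ₂] →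
      GaloisRep.cyclotomicCharacter K p σ ∈ CommGroup.torsion ℤ_[p]ˣ)
    {A : Type} [AddCommGroup A] [Module ℤ_[p] A] [TopologicalSpace A] [DiscreteTopology A]
    [ContinuousSMul ℤ_[p] A] (hA : Nonempty (A ≃+ ℚ_[p] ⧸ (PadicInt.subring p).toAddSubgroup))
    (ρ₀ : ContinuousRep (GaloisGroupUnramifiedOutside K S) ℤ_[p] A)
    (θ : GaloisGroupUnramifiedOutside K S →ₜ* ℤ_[p]ˣ)
    (hρ₀ : ∀ (g : GaloisGroupUnramifiedOutside K S) (a : A), ρ₀ g a = ((θ g : ℤ_[p]ˣ) : ℤ_[p]) • a)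
    (hθ : Nat.Coprime (Nat.card θ.toMonoidHom.range) p)
    [ContinuousSMul (PowerSeries (PowerSeries ℤ_[p])) (IndModule₂ ℤ_[p] p A)] :
    HasCorank (PowerSeries (PowerSeries ℤ_[p])) ((twistDeformation S hS κ₁ κ₂ ρ₀).H 2) 0 :=
  twistDeformation_hasCorank_H2_zero_of_T4
    weakLeopoldt_H2_subsingleton_above_cyclotomic_of_isOpen_holds hp hSf hS hκ hcyc hA ρ₀ θ hρ₀ hθ

end KernelDescent

section KellerYin

open Literature.NumberTheory.EllipticCurves Literature.NumberTheory.EllipticCurves.KellerYin2024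

variable {K : Type} [Field K] [NumberField K] {p : ℕ} [Fact p.Prime]
  (S : Set (HeightOneSpectrum (𝓞 K)))
  (θ : FramedGaloisRep K (padicCoeffIntegers (∅ : Set (PadicAlgCl p))) 1)
  [TopologicalSpace (PowerSeries ℤ_[p])] [TopologicalSpace (PowerSeries (PowerSeries ℤ_[p]))]

/-- **LEO(`𝐃_θ`) for Keller–Yin's character — UNCONDITIONAL** (`twistDeformation_LEO_of_unitChar_of_T4`
with (T4) discharged). [cite: Greenberg2016Selmer, §2.2 p. 6 L22–30] [cite: KellerYin2024, §1.1]
[cite: Greenberg2006, Thm. 3 p. 342, pp. 343–344] -/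
theorem twistDeformation_LEO_of_unitChar'
    (hp : p ≠ 2) (hSf : S.Finite)
    (hS : ∀ v : HeightOneSpectrum (𝓞 K), ((p : ℕ) : 𝓞 K) ∈ v.asIdeal → v ∈ S)
    {κ₁ κ₂ : ZpExtension K p}
    (hκ : Function.Surjective (fun σ : absoluteGaloisGroup K ↦ (κ₁ σ, κ₂ σ)))
    (hcyc : ∀ σ : absoluteGaloisGroup K, σ ∈ multiZpKer p ![κ₁, κ₂] →
      GaloisRep.cyclotomicCharacter K p σ ∈ CommGroup.torsion ℤ_[p]ˣ)
    (h : ramificationSubgroup K S ≤ (unitChar θ).toMonoidHom.ker) {n : ℕ} (hn : 0 < n)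
    (hpn : ¬ p ∣ n) (hθ : ∀ σ : absoluteGaloisGroup K, θ σ ^ n = 1)
    [DiscreteTopology (QpModZp p)] [ContinuousSMul ℤ_[p] (QpModZp p)]
    [IsTopologicalAddGroup (IndModule₂ ℤ_[p] p (QpModZp p))]
    [ContinuousSMul (PowerSeries (PowerSeries ℤ_[p])) (IndModule₂ ℤ_[p] p (QpModZp p))] :
    LEO S (twistDeformation S hS κ₁ κ₂ (characterRepUnramified S θ h)) :=
  twistDeformation_LEO_of_unitChar_of_T4 S θ
    weakLeopoldt_H2_subsingleton_above_cyclotomic_of_isOpen_holds hp hSf hS hκ hcyc h hn hpn hθ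

/-- **`corank H²(K_Σ/K, 𝐃_θ) = 0` for Keller–Yin's character — UNCONDITIONAL**
(`twistDeformation_hasCorank_H2_zero_of_unitChar_of_T4` with (T4) discharged).
[cite: Greenberg2016Selmer, §2.3 p. 7 L1–17] [cite: KellerYin2024, §1.1]
[cite: Greenberg2006, Thm. 3 p. 342, pp. 343–344] -/
theorem twistDeformation_hasCorank_H2_zero_of_unitChar'
    (hp : p ≠ 2) (hSf : S.Finite)
    (hS : ∀ v : HeightOneSpectrum (𝓞 K), ((p : ℕ) : 𝓞 K) ∈ v.asIdeal → v ∈ S)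
    {κ₁ κ₂ : ZpExtension K p}
    (hκ : Function.Surjective (fun σ : absoluteGaloisGroup K ↦ (κ₁ σ, κ₂ σ)))
    (hcyc : ∀ σ : absoluteGaloisGroup K, σ ∈ multiZpKer p ![κ₁, κ₂] →
      GaloisRep.cyclotomicCharacter K p σ ∈ CommGroup.torsion ℤ_[p]ˣ)
    (h : ramificationSubgroup K S ≤ (unitChar θ).toMonoidHom.ker) {n : ℕ} (hn : 0 < n)
    (hpn : ¬ p ∣ n) (hθ : ∀ σ : absoluteGaloisGroup K, θ σ ^ n = 1)
    [DiscreteTopology (QpModZp p)] [ContinuousSMul ℤ_[p] (QpModZp p)]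
    [ContinuousSMul (PowerSeries (PowerSeries ℤ_[p])) (IndModule₂ ℤ_[p] p (QpModZp p))] :
    HasCorank (PowerSeries (PowerSeries ℤ_[p]))
      ((twistDeformation S hS κ₁ κ₂ (characterRepUnramified S θ h)).H 2) 0 :=
  twistDeformation_hasCorank_H2_zero_of_unitChar_of_T4 S θ
    weakLeopoldt_H2_subsingleton_above_cyclotomic_of_isOpen_holds hp hSf hS hκ hcyc h hn hpn hθ

end KellerYin

section Verbatim

open Literature.NumberTheory.EllipticCurves

/-- **Weak Leopoldt above the `ℤ_p²`-extension of an imaginary quadratic field, for a scalar twist of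
order prime to `p` — UNCONDITIONAL**: the statement of the former stub `stub_weakLeopoldtAbove`
(crux line `halves` v6 of `Summits/BirchSwinnertonDyer/…/GoodLatticeBDPValue`) verbatim, now a
hypothesis-free theorem (`weakLeopoldtAbove_of_T4` with (T4) discharged).
[cite: Greenberg2006, pp. 343–344, Thm. 3 p. 342] [cite: NguyenQuangDo1984, Thm. 2.2]
[cite: SerreGaloisCohomology1997, Ch. I §2.4, Proposition 9] [cite: Washington1997, Thm. 13.4] -/
theorem weakLeopoldtAbove :
    ∀ (p : ℕ) [Fact p.Prime] (K : Type) [Field K] [NumberField K], 2 < p →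
      IsImaginaryQuadratic K →
      ∀ (S : Set (HeightOneSpectrum (𝓞 K))), S.Finite →
        (∀ v : HeightOneSpectrum (𝓞 K), ((p : ℕ) : 𝓞 K) ∈ v.asIdeal → v ∈ S) →
      ∀ (κ₁ κ₂ : ZpExtension K p),
        (Function.Surjective fun σ : absoluteGaloisGroup K ↦ (κ₁ σ, κ₂ σ)) →
      ∀ (A : Type) [AddCommGroup A] [Module ℤ_[p] A] [TopologicalSpace A] [DiscreteTopology A]
        [ContinuousSMul ℤ_[p] A], Nonempty (A ≃ₗ[ℤ_[p]] QpModZp p) →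
      ∀ (ρ₀ : ContinuousRep (GaloisGroupUnramifiedOutside K S) ℤ_[p] A) (n : ℕ), 0 < n → ¬ p ∣ n →
        (∀ g : GaloisGroupUnramifiedOutside K S, ∃ t : ℤ_[p]ˣ, ∀ a : A, ρ₀ g a = (t : ℤ_[p]) • a) →
        (∀ g : GaloisGroupUnramifiedOutside K S, ρ₀ g ^ n = 1) →
      Subsingleton ((ρ₀.restrict (galoisGroupAboveSubtype S (multiZpKer p ![κ₁, κ₂]))).H 2) :=
  weakLeopoldtAbove_of_T4 weakLeopoldt_H2_subsingleton_above_cyclotomic_of_isOpen_holds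

end Verbatim

end Literature.NumberTheory.IwasawaTheory.Greenberg2006

end
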